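import Literature.NumberTheory.EllipticCurves.WeierstrassTransformationFive
import Literature.NumberTheory.EllipticCurves.ComplexTorus
import Mathlib.Analysis.Calculus.Deriv.Polynomial
import Mathlib.Analysis.Complex.Cardinality
import HarnessLib

/-!
# For lattices `Λ ⊆ Λ'`, `℘_{Λ'}` is a rational function of `℘_Λ`

Topic `NumberTheory/EllipticCurves`; a proofs-only file (theorems only, no definitions, no named
facts) in `namespace PeriodPair` (deliberate dot-notation extensions of Mathlib's `PeriodPair`,
as in the sibling files `WeierstrassTransformation*.lean`, `LatticeEndomorphism*.lean`).

Let `Λ ⊆ Λ'` be lattices in `ℂ` (period pairs `L`, `L'` with `L.lattice ≤ L'.lattice`). Then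
`Λ` has finite index in `Λ'`, and the classical theory of transformations of `℘` gives
`℘_{Λ'}(z) = Σ_{c ∈ S} ℘_Λ(z − c) − Σ_{c ∈ S, c ≠ 0} ℘_Λ(c)` for a system of representatives
`S ∋ 0` of `Λ'/Λ` (Lawden, *Elliptic Functions and Applications*, §9.8; the tree's
`PeriodPair.weierstrassP_transformation`, `WeierstrassTransformationFive.lean`). Grouping `z − c`
with `z + c` by the evenness of `℘_{Λ'}` and using the addition theorem (the tree's
`PeriodPair.weierstrassP_add_holds`) in the symmetric form

  `½(℘(z − c) + ℘(z + c)) = (f(℘ z) + f(℘ c)) / (4 (℘ z − ℘ c)²) − ℘ z − ℘ c`,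
  `f(X) = 4X³ − g₂X − g₃`

(Lawden (6.8.8); Whittaker–Watson §20.3 and §20.33 Example 1), one obtains the statement proved
here: **`℘_{Λ'} = P(℘_Λ)/Q(℘_Λ)` for polynomials `P, Q ∈ ℂ[X]`, `Q ≠ 0`, with
`Q(℘_Λ(z)) ≠ 0` off `Λ'`** — the `x`-coordinate of the isogeny `ℂ/Λ → ℂ/Λ'`, `z ↦ z`, is a
rational function (Silverman, *AEC*, VI.4.1 with III.4; Cox, *Primes of the form x² + ny²*,
Prop. 14.9 / Thm. 10.14 for the complex-multiplication case, which the tree has as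
`PeriodPair.eval_weierstrassP_eq_weierstrassP_mul_mul`).

* `PeriodPair.exists_finset_representatives` — a finite system of representatives `S ∋ 0` of
  `Λ'/Λ` inside `Λ'` (the points of `Λ'` in the fundamental parallelogram of `Λ`; Mathlib's
  `ZSpan.fract`, `ZSpan.setFinite_inter`); in particular `[Λ' : Λ] < ∞`.
* `PeriodPair.weierstrassP_sub_add_weierstrassP_add` — the symmetric addition formula above.
* `PeriodPair.weierstrassP_eq_sum_symm_of_le` — `℘_{Λ'}(z) = ℘_Λ(z) + Σ_{c ∈ S∖0} ½(℘_Λ(z − c) +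
  ℘_Λ(z + c)) − Σ_{c ∈ S∖0} ℘_Λ(c)` for `z ∉ Λ'`.
* `PeriodPair.exists_polynomial_weierstrassP_mul_eval_eq_of_le` — **main statement**:
  `∃ P Q`, `Q ≠ 0`, `Q(℘_Λ z) ≠ 0` and `℘_{Λ'}(z) · Q(℘_Λ z) = P(℘_Λ z)` for all `z ∉ Λ'`.

## References

* D. F. Lawden, *Elliptic Functions and Applications*, Springer 1989: §9.8 (transformations of
  order `n`), §6.8 ((6.8.8): `℘(u + v) + ℘(u − v)`). [Lawden1989]
* E. T. Whittaker, G. N. Watson, *A Course of Modern Analysis*, 4th ed., Cambridge 1927: §20.3,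
  §20.33. [WhittakerWatson1927]
* J. H. Silverman, *The Arithmetic of Elliptic Curves*, 2nd ed., GTM 106, Springer 2009:
  Thm. VI.4.1, III.4. [SilvermanAEC2009]
-/

noncomputable section

open Complex Set Polynomial Filter Topology

namespace PeriodPair

variable (L L' : PeriodPair)

/-! ### A finite system of representatives of `Λ'/Λ` -/

/-- **Representatives of `Λ'/Λ`.** If `Λ ⊆ Λ'` are lattices (period pairs), the points of `Λ'`
lying in the half-open fundamental parallelogram of `Λ` form a finite set `S ∋ 0` of
representatives of `Λ'/Λ`: every `x ∈ Λ'` is congruent modulo `Λ` to exactly one `c ∈ S`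
(Mathlib's `ZSpan.fract`; finiteness by `ZSpan.setFinite_inter`, a bounded set meets a lattice
in finitely many points). In particular `Λ` has finite index in `Λ'`. [folklore] -/
theorem exists_finset_representatives (h : L.lattice ≤ L'.lattice) :
    ∃ S : Finset ℂ, (0 : ℂ) ∈ S ∧ (↑S ⊆ (L'.lattice : Set ℂ)) ∧
      (∀ x, x ∈ L'.lattice ↔ ∃ c ∈ S, x - c ∈ L.lattice) ∧
      (∀ c ∈ S, ∀ c' ∈ S, c - c' ∈ L.lattice → c = c') := by
  set b := L.basis with hb
  have hΛ : L.lattice = Submodule.span ℤ (Set.range b) := L.lattice_eq_span_range_basis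
  set T : Set ℂ := ZSpan.fundamentalDomain b ∩ (L'.lattice : Set ℂ) with hT
  have hTfin : T.Finite := by
    have := ZSpan.setFinite_inter L'.basis (ZSpan.fundamentalDomain_isBounded b)
    rwa [← L'.lattice_eq_span_range_basis] at this
  refine ⟨hTfin.toFinset, ?_, ?_, ?_, ?_⟩
  · simp only [Finite.mem_toFinset, hT, mem_inter_iff, SetLike.mem_coe]
    refine ⟨?_, zero_mem _⟩
    rw [ZSpan.mem_fundamentalDomain]
    intro i
    simp
  · intro c hc
    exact ((Finite.mem_toFinset _).mp hc).2
  · intro x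
    constructor
    · intro hx
      refine ⟨ZSpan.fract b x, ?_, ?_⟩
      · rw [Finite.mem_toFinset]
        refine ⟨ZSpan.fract_mem_fundamentalDomain b x, ?_⟩
        rw [SetLike.mem_coe, ZSpan.fract_apply]
        refine sub_mem hx (h ?_)
        rw [hΛ]
        exact (ZSpan.floor b x).2
      · rw [ZSpan.fract_apply, sub_sub_cancel, hΛ]
        exact (ZSpan.floor b x).2
    · rintro ⟨c, hc, hxc⟩
      have hc' : c ∈ L'.lattice := ((Finite.mem_toFinset _).mp hc).2
      simpa using add_mem (h hxc) hc'
  · intro c hc c' hc' hcc'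
    have hcF : c ∈ ZSpan.fundamentalDomain b := ((Finite.mem_toFinset _).mp hc).1
    have hc'F : c' ∈ ZSpan.fundamentalDomain b := ((Finite.mem_toFinset _).mp hc').1
    have h1 : ZSpan.fract b c = c := (ZSpan.fract_eq_self).mpr hcF
    have h2 : ZSpan.fract b c' = c' := (ZSpan.fract_eq_self).mpr hc'F
    have h3 : ZSpan.fract b c' = ZSpan.fract b c := by
      rw [ZSpan.fract_eq_fract, ← hΛ]
      simpa [neg_add_eq_sub] using hcc'
    rw [← h1, ← h2, h3]

/-! ### The symmetric addition formula -/

/-- **`℘(z − c) + ℘(z + c)` is a rational function of `℘(z)`**: for `z, c ∉ Λ` with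
`℘(z) ≠ ℘(c)` (i.e. `z ≢ ±c`),
`½(℘(z − c) + ℘(z + c)) = (f(℘ z) + f(℘ c)) / (4(℘ z − ℘ c)²) − ℘ z − ℘ c` with
`f(X) = 4X³ − g₂X − g₃` — add the addition theorem (`weierstrassP_add_holds`) for `z + c` and for
`z + (−c)`; the cross terms `±2℘′(z)℘′(c)` cancel and `℘′² = f(℘)`
(Lawden (6.8.8): `℘(u + v) + ℘(u − v) = {2(℘u℘v − ¼g₂)(℘u + ℘v) − g₃}/(℘u − ℘v)²`, an
equivalent form). [cite: Lawden1989, §6.8 eq. (6.8.8)] -/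
theorem weierstrassP_sub_add_weierstrassP_add {z c : ℂ} (hz : z ∉ L.lattice) (hc : c ∉ L.lattice)
    (hne : ℘[L] z ≠ ℘[L] c) :
    (℘[L] (z - c) + ℘[L] (z + c)) / 2 =
      ((4 * ℘[L] z ^ 3 - L.g₂ * ℘[L] z - L.g₃) + (4 * ℘[L] c ^ 3 - L.g₂ * ℘[L] c - L.g₃)) /
          (4 * (℘[L] z - ℘[L] c) ^ 2) - ℘[L] z - ℘[L] c := by
  have hnc : -c ∉ L.lattice := fun h ↦ hc (by simpa using neg_mem h)
  have h1 := L.weierstrassP_add_holds z c hz hc hne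
  have hne' : ℘[L] z ≠ ℘[L] (-c) := by rwa [L.weierstrassP_neg]
  have h2 := L.weierstrassP_add_holds z (-c) hz hnc hne'
  rw [L.weierstrassP_neg, L.derivWeierstrassP_neg, ← sub_eq_add_neg] at h2
  have hD : ℘[L] z - ℘[L] c ≠ 0 := sub_ne_zero.mpr hne
  rw [h1, h2, ← L.derivWeierstrassP_sq z hz, ← L.derivWeierstrassP_sq c hc]
  field_simp
  ring

/-! ### The transformation formula in symmetric form -/

variable {L L'}

/-- **The transformation of order `n`, symmetrised.** For lattices `Λ ⊆ Λ'`, a system of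
representatives `S ∋ 0` of `Λ'/Λ` and `z ∉ Λ'`:
`℘_{Λ'}(z) = ℘_Λ(z) + Σ_{c ∈ S, c ≠ 0} ½(℘_Λ(z − c) + ℘_Λ(z + c)) − Σ_{c ∈ S, c ≠ 0} ℘_Λ(c)`
— the tree's `weierstrassP_transformation` (`℘_{Λ'}(z) = Σ_{c ∈ S} ℘_Λ(z − c) − Σ' ℘_Λ(c)`,
Lawden §9.8) averaged over `z` and `−z`, using that `℘_{Λ'}` and `℘_Λ` are even.
[cite: Lawden1989, §9.8 eqs. (9.8.3)–(9.8.7), (9.8.14)] -/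
theorem weierstrassP_eq_sum_symm_of_le {S : Finset ℂ}
    (hS : ∀ x, x ∈ L'.lattice ↔ ∃ c ∈ S, x - c ∈ L.lattice) (hS0 : (0 : ℂ) ∈ S)
    (hSd : ∀ c ∈ S, ∀ c' ∈ S, c - c' ∈ L.lattice → c = c') {z : ℂ} (hz : z ∉ L'.lattice) :
    ℘[L'] z = ℘[L] z + ∑ c ∈ S.erase 0, (℘[L] (z - c) + ℘[L] (z + c)) / 2 -
      ∑ c ∈ S.erase 0, ℘[L] c := by
  have hz' : -z ∉ L'.lattice := fun h ↦ hz (by simpa using neg_mem h)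
  have h1 := weierstrassP_transformation hS hS0 hSd hz
  have h2 := weierstrassP_transformation hS hS0 hSd hz'
  rw [L'.weierstrassP_neg] at h2
  have h2' : ∑ c ∈ S, ℘[L] (-z - c) = ∑ c ∈ S, ℘[L] (z + c) :=
    Finset.sum_congr rfl fun c _ ↦ by rw [← L.weierstrassP_neg (-z - c)]; ring_nf
  rw [h2'] at h2
  have hsum : ∑ c ∈ S, (℘[L] (z - c) + ℘[L] (z + c)) / 2 =
      ℘[L] z + ∑ c ∈ S.erase 0, (℘[L] (z - c) + ℘[L] (z + c)) / 2 := by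
    rw [← Finset.add_sum_erase S _ hS0]
    simp
  have hcomb : ℘[L'] z = ∑ c ∈ S, (℘[L] (z - c) + ℘[L] (z + c)) / 2 -
      ∑ c ∈ S.erase 0, ℘[L] c := by
    have hsplit : ∑ c ∈ S, (℘[L] (z - c) + ℘[L] (z + c)) / 2 =
        (∑ c ∈ S, ℘[L] (z - c) + ∑ c ∈ S, ℘[L] (z + c)) / 2 := by
      rw [← Finset.sum_add_distrib, Finset.sum_div]
    rw [hsplit]
    linear_combination (h1 + h2) / 2
  rw [hcomb, hsum]

/-! ### `℘_{Λ'}` is a rational function of `℘_Λ` -/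

/-- Closure step: a finite sum of functions each of the form `P_c(℘ z)/Q_c(℘ z)` on a set `U`
(with `Q_c(℘ z) ≠ 0` on `U`) is again of that form, with denominator `∏ Q_c`. [folklore] -/
theorem exists_polynomial_sum_mul_eval_eq {ι : Type*} (s : Finset ι) {U : Set ℂ}
    {F : ι → ℂ → ℂ}
    (hF : ∀ i ∈ s, ∃ P Q : ℂ[X], (∀ z ∈ U, Q.eval (℘[L] z) ≠ 0) ∧
      ∀ z ∈ U, F i z * Q.eval (℘[L] z) = P.eval (℘[L] z)) :
    ∃ P Q : ℂ[X], (∀ z ∈ U, Q.eval (℘[L] z) ≠ 0) ∧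
      ∀ z ∈ U, (∑ i ∈ s, F i z) * Q.eval (℘[L] z) = P.eval (℘[L] z) := by
  classical
  induction s using Finset.induction_on with
  | empty => exact ⟨0, 1, fun z _ ↦ by simp, fun z _ ↦ by simp⟩
  | @insert i s hi ih =>
    obtain ⟨P₁, Q₁, hQ₁, h₁⟩ := hF i (Finset.mem_insert_self i s)
    obtain ⟨P₂, Q₂, hQ₂, h₂⟩ := ih fun j hj ↦ hF j (Finset.mem_insert_of_mem hj)
    refine ⟨P₁ * Q₂ + P₂ * Q₁, Q₁ * Q₂, fun z hz ↦ ?_, fun z hz ↦ ?_⟩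
    · rw [eval_mul]
      exact mul_ne_zero (hQ₁ z hz) (hQ₂ z hz)
    · rw [Finset.sum_insert hi, eval_add, eval_mul, eval_mul, eval_mul, ← h₁ z hz, ← h₂ z hz]
      ring

variable (L L')

/-- **`℘_{Λ'}` is a rational function of `℘_Λ` for `Λ ⊆ Λ'`.** There are polynomials
`P, Q ∈ ℂ[X]`, `Q ≠ 0`, such that for every `z ∉ Λ'` one has `Q(℘_Λ(z)) ≠ 0` and
`℘_{Λ'}(z) · Q(℘_Λ(z)) = P(℘_Λ(z))`. Explicitly `Q = ∏_{c ∈ S, c ≠ 0} (X − ℘_Λ(c))²` for a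
system of representatives `S ∋ 0` of `Λ'/Λ` (`exists_finset_representatives`), by the
symmetrised transformation formula (`weierstrassP_eq_sum_symm_of_le`) and the symmetric addition
formula (`weierstrassP_sub_add_weierstrassP_add`): for `z ∉ Λ'` and `c ∈ S ∖ {0}` one has
`z, c ∉ Λ` and `℘_Λ(z) ≠ ℘_Λ(c)` (else `z ≡ ±c (mod Λ)`, `z ∈ Λ'`). This is the
`x`-coordinate of the isogeny `ℂ/Λ → ℂ/Λ'`, `z ↦ z` (Silverman, *AEC*, Thm. VI.4.1 with
III.4: isogenies are given by rational functions).
[cite: Lawden1989, §9.8 with §6.8 eq. (6.8.8)] -/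
theorem exists_polynomial_weierstrassP_mul_eval_eq_of_le (h : L.lattice ≤ L'.lattice) :
    ∃ P Q : ℂ[X], Q ≠ 0 ∧ (∀ z ∉ L'.lattice, Q.eval (℘[L] z) ≠ 0) ∧
      ∀ z ∉ L'.lattice, ℘[L'] z * Q.eval (℘[L] z) = P.eval (℘[L] z) := by
  classical
  obtain ⟨S, hS0, hSΛ', hS, hSd⟩ := L.exists_finset_representatives L' h
  set U : Set ℂ := (L'.lattice : Set ℂ)ᶜ with hU
  set K : ℂ := ∑ c ∈ S.erase 0, ℘[L] c with hK
  -- facts about `z ∉ Λ'` and `c ∈ S ∖ {0}`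
  have hcS : ∀ c ∈ S.erase 0, c ∉ L.lattice := by
    intro c hc hcΛ
    have hc0 : c ≠ 0 := Finset.ne_of_mem_erase hc
    exact hc0 (hSd c (Finset.mem_of_mem_erase hc) 0 hS0 (by simpa using hcΛ))
  have hzU : ∀ z ∈ U, z ∉ L.lattice := fun z hz hzΛ ↦ hz (h hzΛ)
  have hne : ∀ z ∈ U, ∀ c ∈ S.erase 0, ℘[L] z ≠ ℘[L] c := by
    intro z hz c hc heq
    have hcΛ' : c ∈ L'.lattice := hSΛ' (Finset.mem_of_mem_erase hc)
    rcases (L.weierstrassP_eq_weierstrassP_iff (hzU z hz) (hcS c hc)).mp heq with h' | h'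
    · exact hz (by simpa using sub_mem (h h') hcΛ')
    · exact hz (by simpa using add_mem (h h') hcΛ')
  -- each symmetric summand is rational in `℘ z`
  set F : ℂ → ℂ → ℂ := fun c z ↦ (℘[L] (z - c) + ℘[L] (z + c)) / 2 with hF
  have hFrat : ∀ c ∈ S.erase 0, ∃ P Q : ℂ[X], (∀ z ∈ U, Q.eval (℘[L] z) ≠ 0) ∧
      ∀ z ∈ U, F c z * Q.eval (℘[L] z) = P.eval (℘[L] z) := by
    intro c hc
    refine ⟨(X ^ 3 - C (L.g₂ / 4) * X - C (L.g₃ / 4) +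
        C ((4 * ℘[L] c ^ 3 - L.g₂ * ℘[L] c - L.g₃) / 4)) -
        (X + C (℘[L] c)) * (X - C (℘[L] c)) ^ 2, (X - C (℘[L] c)) ^ 2,
      fun z hz ↦ ?_, fun z hz ↦ ?_⟩
    · have hD : ℘[L] z - ℘[L] c ≠ 0 := sub_ne_zero.mpr (hne z hz c hc)
      simp only [eval_pow, eval_sub, eval_X, eval_C]
      exact pow_ne_zero 2 hD
    · have hD : ℘[L] z - ℘[L] c ≠ 0 := sub_ne_zero.mpr (hne z hz c hc)
      simp only [hF, eval_mul, eval_C, eval_pow, eval_sub, eval_X, eval_add]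
      rw [L.weierstrassP_sub_add_weierstrassP_add (hzU z hz) (hcS c hc) (hne z hz c hc)]
      field_simp
      ring
  obtain ⟨P₀, Q₀, hQ₀, hPQ₀⟩ := L.exists_polynomial_sum_mul_eval_eq (S.erase 0) hFrat
  -- assemble: `℘' z = ℘ z + Σ F c z - K`
  refine ⟨(X - C K) * Q₀ + P₀, Q₀, ?_, fun z hz ↦ hQ₀ z hz, fun z hz ↦ ?_⟩
  · intro hQ
    exact hQ₀ (L'.ω₁ / 2) L'.ω₁_div_two_notMem_lattice (by simp [hQ])
  · rw [weierstrassP_eq_sum_symm_of_le hS hS0 hSd hz, eval_add, eval_mul, eval_sub, eval_X,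
      eval_C, ← hPQ₀ z hz]
    ring

/-! ### The algebraic form of the transformation: a polynomial identity -/

/-- **The transformation identity in algebraic form.** If `Λ ⊆ Λ'` and
`℘_{Λ'}(z) · Q(℘_Λ z) = P(℘_Λ z)` for all `z ∉ Λ'` (`exists_polynomial_weierstrassP_mul_eval_eq_of_le`),
then, writing `f = 4X³ − g₂X − g₃` (invariants of `Λ`) and `g₂', g₃'` for the invariants of
`Λ'`, the polynomials satisfy

  `(P′Q − PQ′)² · f = Q · (4P³ − g₂′ P Q² − g₃′ Q³)` in `ℂ[X]`,

i.e. `T = P/Q` solves `T′(X)² f(X) = 4T(X)³ − g₂′T(X) − g₃′`. Proof: differentiating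
`℘_{Λ'} Q(℘_Λ) = P(℘_Λ)` gives `℘′_{Λ'} Q(℘_Λ)² = ℘′_Λ (P′Q − PQ′)(℘_Λ)`; square and use
`℘′² = 4℘³ − g₂℘ − g₃` for both lattices; the resulting polynomial identity holds at `℘_Λ(z)`
for all `z ∉ Λ'`, an uncountable set of values (`℘_Λ` is onto `ℂ`, `exists_weierstrassP_eq`, and
`℘_Λ(Λ')` is countable), hence identically. This is the equation
`(dy/du)² = 4y³ − g₂′y − g₃′` for `y = T(℘_Λ(u))`, cf. Whittaker–Watson §20.22 and, for the
complex-multiplication analogue `u = (P/Q)(℘)`, `u′² = α² f(u)`, Cox Prop. 14.9 (tree: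
`LatticeEndomorphism.lean`, hypothesis `(H1)`). [folklore] -/
theorem transformation_polynomial_identity {P Q : ℂ[X]} (h : L.lattice ≤ L'.lattice)
    (hPQ : ∀ z ∉ L'.lattice, ℘[L'] z * Q.eval (℘[L] z) = P.eval (℘[L] z)) :
    (derivative P * Q - P * derivative Q) ^ 2 * (4 * X ^ 3 - C L.g₂ * X - C L.g₃) =
      Q * (4 * P ^ 3 - C L'.g₂ * P * Q ^ 2 - C L'.g₃ * Q ^ 3) := by
  set H : ℂ[X] := (derivative P * Q - P * derivative Q) ^ 2 * (4 * X ^ 3 - C L.g₂ * X - C L.g₃) -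
    Q * (4 * P ^ 3 - C L'.g₂ * P * Q ^ 2 - C L'.g₃ * Q ^ 3) with hH
  -- Step 1: the identity holds at `x = ℘_Λ z` for `z ∉ Λ'`
  have key : ∀ z ∉ L'.lattice, H.IsRoot (℘[L] z) := by
    intro z hz
    have hzΛ : z ∉ L.lattice := fun h' ↦ hz (h h')
    -- the derivative of `w ↦ ℘_{Λ'} w · Q(℘ w) − P(℘ w)`, which vanishes near `z`, is zero
    have hG0 : (fun _ : ℂ ↦ (0 : ℂ)) =ᶠ[𝓝 z]
        fun w ↦ ℘[L'] w * Q.eval (℘[L] w) - P.eval (℘[L] w) := by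
      filter_upwards [L'.isClosed_lattice.isOpen_compl.mem_nhds hz] with w hw
      rw [hPQ w hw, sub_self]
    have hd1 : HasDerivAt ℘[L'] (℘'[L'] z) z := L'.hasDerivAt_weierstrassP hz
    have hdQ : HasDerivAt (fun w ↦ Q.eval (℘[L] w))
        ((derivative Q).eval (℘[L] z) * ℘'[L] z) z :=
      (Q.hasDerivAt (℘[L] z)).comp z (L.hasDerivAt_weierstrassP hzΛ)
    have hdP : HasDerivAt (fun w ↦ P.eval (℘[L] w))
        ((derivative P).eval (℘[L] z) * ℘'[L] z) z :=
      (P.hasDerivAt (℘[L] z)).comp z (L.hasDerivAt_weierstrassP hzΛ)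
    have hdG := ((hd1.mul hdQ).sub hdP).congr_of_eventuallyEq hG0
    have E2 : ℘'[L'] z * Q.eval (℘[L] z) +
        ℘[L'] z * ((derivative Q).eval (℘[L] z) * ℘'[L] z) -
        (derivative P).eval (℘[L] z) * ℘'[L] z = 0 :=
      hdG.unique (hasDerivAt_const z (0 : ℂ))
    have E1 := hPQ z hz
    have E3 := L.derivWeierstrassP_sq z hzΛ
    have E4 := L'.derivWeierstrassP_sq z hz
    -- abbreviations
    set x := ℘[L] z
    set y := ℘'[L] z
    set u := ℘[L'] z
    set u' := ℘'[L'] z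
    set p := P.eval x
    set q := Q.eval x
    set p' := (derivative P).eval x
    set q' := (derivative Q).eval x
    have s1 : y * (p' * q - p * q') = u' * q ^ 2 := by
      linear_combination (-q) * E2 + (y * q') * E1
    have s2 : (y * (p' * q - p * q')) ^ 2 = u' ^ 2 * q ^ 4 := by rw [s1]; ring
    simp only [hH, IsRoot.def, eval_sub, eval_mul, eval_pow, eval_X, eval_C, eval_ofNat]
    linear_combination (4 * q * ((q * u) ^ 2 + q * u * p + p ^ 2) - L'.g₂ * q ^ 3) * E1 -
      (p' * q - p * q') ^ 2 * E3 + q ^ 4 * E4 + s2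
  -- Step 2: `H` has uncountably many roots, hence `H = 0`
  have hroots : (℘[L] '' (L'.lattice : Set ℂ))ᶜ ⊆ {x | H.IsRoot x} := by
    intro x hx
    obtain ⟨z, hzΛ, rfl⟩ := L.exists_weierstrassP_eq x
    have hz : z ∉ L'.lattice := fun h' ↦ hx ⟨z, h', rfl⟩
    exact key z hz
  have hinf : {x | H.IsRoot x}.Infinite := by
    intro hfin
    have h1 : ((℘[L] '' (L'.lattice : Set ℂ))ᶜ).Countable := (hfin.subset hroots).countable
    have h2 : (℘[L] '' (L'.lattice : Set ℂ)).Countable := L'.countable_lattice.image _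
    exact not_countable_complex (by simpa using h2.union h1)
  exact sub_eq_zero.mp (H.eq_zero_of_infinite_isRoot hinf)

end PeriodPair

end
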